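import Summits.NavierStokesRegularity.NavierStokesRegularity.Theses.LerayQuarterDissipation
import Summits.NavierStokesRegularity.NavierStokesRegularity.Theorems.SymmetricLiouville.Negative.NonlinearLoadBearing
import Summits.NavierStokesRegularity.NavierStokesRegularity.Theorems.SymmetricLiouville.Negative.SmallConstantGap
import Summits.NavierStokesRegularity.NavierStokesRegularity.Theorems.ForcedSymmetry.Negative.RotatingParasite

/-!
# Crux `FiniteDissipationLiouville` (stmt-NavierStokesRegularity-22144), negative side:
# the Oseen gauge is load-bearing; the degenerate parameter corners hold

Negative-side (cdisprove, D-0016) support lemmas for the crux `FiniteDissipationLiouville` (FDL) of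
route `LerayQuarterDissipation`,

  `∀ C K ū, IsTypeIAncientMild C ū → (∀ s < 0, ∫⁻ ‖D ū(s)‖ₑ² ≤ K/√(−s)) → ¬ SingularAtApex ū`

(a Type-I ancient mild solution in the Koch–Nadirashvili–Seregin–Šverák gauge whose slices obey
Leray's quarter-rate dissipation law is bounded at the apex `(0,0)`; "singular at the apex" is the
negated conclusion `∀ r > 0, ∀ M, ∃ (t, x) ∈ (−r², 0) × B_r, M < ‖ū t x‖`). All clauses are written
inline, verbatim from the route file, so the lemmas speak about the crux's own hypotheses. No new
definitions; standard axioms.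

THE WITNESS FAMILY is the rotating Leray-rate parasitic stream of the sibling negative file
`ForcedSymmetry/Negative/RotatingParasite.lean`: `ū_α(t, x) = (√(−t))⁻¹ R(αs) e₀`, `s = −log(−t)`
(`vecDrift (rotConst α)`; at `α = 0` the plain KNSS parasitic solution `u = b(t)`, `p = −b′(t)·x`
with the profile `b = (−t)^{−1/2}` saturating the Type-I bound; for `α ≠ 0` the Pineau–Vicol RSS
ansatz with constant profile). For EVERY `α` it is jointly smooth and divergence free on `t < 0`,
Type I with `C = 1`, satisfies the dissipation law with EVERY `K` (even `K = 0`: `Dū ≡ 0`), is a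
classical Navier–Stokes solution on `(−∞, 0) × ℝ³` with the linear pressure `−⟪c′(t), x⟫`, and is
SINGULAR at the apex (`rotConst_singular`: `‖ū(−ρ², 0)‖ = ρ⁻¹`).

* LOAD-BEARING (`finiteDissipationLiouville_false_without_mild`): dropping the Oseen integral
  equation from the class — keeping joint smoothness, `div = 0`, the Type-I bound and the
  dissipation law — makes FDL false. `finiteDissipationLiouville_false_classical`: replacing the
  gauge by the classical PDE with a pressure also makes it false. The gauge removes every witness of
  the family (`rotConst_not_isTypeIAncientMild`, tree `IsTypeIAncientMild.eq_zero_of_slice_const`),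
  so FDL itself is untouched: any proof of FDL must use the KNSS gauge, not only the equations, and
  no RSS/DSS-costume of a parasitic drift can refute it.
* The LIOUVILLE-form upgrade (conclusion `ū ≡ 0`) is false for BOUNDED members of the dissipative
  mild class (`dissipativeLiouville_false_bounded`: constants; KNSS 2009 Rem. 6.1); constants are
  bounded at the apex, so the regularity form of FDL is the robust one, and only the Type-I decay
  as `t → −∞` excludes them.
* DEGENERATE CORNERS HOLD: `K ≤ 0` forces `ū ≡ 0` (`eq_zero_of_dissLaw_nonpos`, `fdl_of_nonpos`:
  `Dū(s)` is continuous and vanishes a.e., so every slice is constant and the gauge kills it), and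
  `C ≤ ε₀` forces `ū ≡ 0` (`fdl_of_small_typeI_constant`, from the accepted small-constant gap
  `exists_eps_vanishes_of_le` of the sibling crux `SymmetricLiouville`). A counterexample to FDL, if
  any, has `K > 0` and `C > ε₀` and is a genuine (non-parasitic) singular Type-I ancient solution.
* SANITY (`fdl_hypotheses_inhabited`): the rest state satisfies all hypotheses and the conclusion.

References: G. Koch, N. Nadirashvili, G. Seregin, V. Šverák, Acta Math. 203 (2009), §1 p. 3 and
Rem. 6.1 (arXiv:0709.3599); B. Pineau, V. Vicol, arXiv:2607.09619, (1.7).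
-/

noncomputable section

open Set Function Filter MeasureTheory InnerProductSpace
open scoped ContDiff RealInnerProductSpace Topology ENNReal

namespace Summit.NavierStokesRegularity.NavierStokesRegularity.Theorems.FiniteDissipationLiouville.Negative

open Literature.Analysis.FluidPDE
open Summit.NavierStokesRegularity.NavierStokesRegularity.Theorems.SymmetricLiouville.Negative
open Summit.NavierStokesRegularity.NavierStokesRegularity.Theorems.ForcedSymmetry.Negative.RotatingParasite

/-! ## Two bookkeeping lemmas on the crux's clauses -/

/-- A field vanishing on the past is not singular at the apex (negated conclusion of the crux). -/
theorem not_singularAtApex_of_vanishes {u : ℝ → E3 → E3} (hu : ∀ t < 0, ∀ x, u t x = 0) :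
    ¬ (∀ r > 0, ∀ M : ℝ, ∃ t ∈ Set.Ioo (-(r ^ 2)) (0 : ℝ),
      ∃ x ∈ Metric.ball (0 : E3) r, M < ‖u t x‖) := by
  intro h
  obtain ⟨t, ht, x, -, hM⟩ := h 1 one_pos 0
  rw [hu t ht.2 x, norm_zero] at hM
  exact lt_irrefl 0 hM

/-- The dissipation law of the crux holds, with every constant `K`, along a field all of whose
slices are spatially constant (`Dū ≡ 0`, the left side is `0`). -/
theorem dissLaw_vecDrift (K : ℝ) (c : ℝ → E3) :
    ∀ s : ℝ, s < 0 → ∫⁻ x, ‖fderiv ℝ (vecDrift c s) x‖ₑ ^ 2 ≤ ENNReal.ofReal (K / Real.sqrt (-s)) := by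
  intro s _
  have h0 : (fun x : E3 => ‖fderiv ℝ (vecDrift c s) x‖ₑ ^ 2) = fun _ => 0 := by
    funext x
    have hx : ‖fderiv ℝ (vecDrift c s) x‖ = 0 := by
      rw [show vecDrift c s = fun _ : E3 => c s from rfl]
      simp
    rw [← ofReal_norm, hx, ENNReal.ofReal_zero, zero_pow two_ne_zero]
  rw [h0, lintegral_zero]
  exact bot_le

/-! ## Sanity: the hypotheses of the crux are satisfiable and the conclusion holds there -/

/-- The rest state is a member of the dissipative Type-I class and is bounded at the apex: the crux
is neither vacuous nor refuted by the trivial solution. -/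
theorem fdl_hypotheses_inhabited :
    ∃ (C K : ℝ) (u : ℝ → E3 → E3), IsTypeIAncientMild C u ∧
      (∀ s : ℝ, s < 0 → ∫⁻ x, ‖fderiv ℝ (u s) x‖ₑ ^ 2 ≤ ENNReal.ofReal (K / Real.sqrt (-s))) ∧
      ¬ (∀ r > 0, ∀ M : ℝ, ∃ t ∈ Set.Ioo (-(r ^ 2)) (0 : ℝ),
          ∃ x ∈ Metric.ball (0 : E3) r, M < ‖u t x‖) :=
  ⟨0, 0, vecDrift fun _ => 0, isTypeIAncientMild_zero le_rfl, dissLaw_vecDrift 0 fun _ => 0,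
    not_singularAtApex_of_vanishes fun _ _ _ => rfl⟩

/-! ## The witness family: rotating Leray-rate parasitic streams are singular at the apex -/

/-- **The rotating parasitic stream is singular at the apex** at every rotation rate:
`‖ū_α(−ρ², 0)‖ = ρ⁻¹` exceeds every `M` inside every backward cylinder `(−r², 0) × B_r`. -/
theorem rotConst_singular (α : ℝ) :
    ∀ r > 0, ∀ M : ℝ, ∃ t ∈ Set.Ioo (-(r ^ 2)) (0 : ℝ),
      ∃ x ∈ Metric.ball (0 : E3) r, M < ‖vecDrift (rotConst α) t x‖ := by
  intro r hr M
  set ρ : ℝ := min (r / 2) (1 / (|M| + 1)) with hρ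
  have hρpos : 0 < ρ := lt_min (by positivity) (by positivity)
  have hρr : ρ < r := (min_le_left _ _).trans_lt (by linarith)
  have hρM : ρ ≤ 1 / (|M| + 1) := min_le_right _ _
  have hρ2 : 0 < ρ ^ 2 := pow_pos hρpos 2
  have ht : -(ρ ^ 2) < 0 := by linarith
  refine ⟨-(ρ ^ 2), ⟨?_, ht⟩, 0, Metric.mem_ball_self hr, ?_⟩
  · have : ρ ^ 2 < r ^ 2 := by nlinarith
    linarith
  · show M < ‖rotConst α (-(ρ ^ 2))‖
    rw [norm_rotConst α ht, neg_neg, Real.sqrt_sq hρpos.le]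
    calc M ≤ |M| := le_abs_self M
      _ < |M| + 1 := lt_add_one _
      _ = 1 / (1 / (|M| + 1)) := by rw [one_div_one_div]
      _ ≤ 1 / ρ := one_div_le_one_div_of_le hρpos hρM
      _ = ρ⁻¹ := one_div ρ

/-! ## Load-bearing hypotheses -/

/-- **The KNSS gauge is load-bearing.** FDL with the Oseen integral equation DROPPED from the class
— keeping joint smoothness, incompressibility, the Type-I bound and the dissipation law — is false:
the rotating Leray-rate parasitic stream (any `α`; `C = 1`, `K = 0`). Any proof of FDL must use
the gauge (which removes these witnesses, `rotConst_not_isTypeIAncientMild`). -/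
theorem finiteDissipationLiouville_false_without_mild :
    ¬ (∀ (C K : ℝ) (u : ℝ → E3 → E3),
        ContDiffOn ℝ (⊤ : ℕ∞) (uncurry u) (Iio 0 ×ˢ univ) →
        (∀ t < 0, VectorCalculus.IsDivFree (u t)) →
        HasTypeITimeDecay C u →
        (∀ s : ℝ, s < 0 → ∫⁻ x, ‖fderiv ℝ (u s) x‖ₑ ^ 2 ≤ ENNReal.ofReal (K / Real.sqrt (-s))) →
        ¬ (∀ r > 0, ∀ M : ℝ, ∃ t ∈ Set.Ioo (-(r ^ 2)) (0 : ℝ),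
            ∃ x ∈ Metric.ball (0 : E3) r, M < ‖u t x‖)) := fun h =>
  h 1 0 (vecDrift (rotConst 0)) (isClassicalNSSolutionOn_vecDrift (contDiffOn_rotConst 0)).smooth_velocity
    (fun t ht => (isClassicalNSSolutionOn_vecDrift (contDiffOn_rotConst 0)).divFree t ht)
    (rotConst_hasTypeITimeDecay 0) (dissLaw_vecDrift 0 _) (rotConst_singular 0)

/-- **The PDE with a pressure does not replace the gauge.** FDL over classical Navier–Stokes
solutions `(u, p)` on `(−∞, 0) × ℝ³` (unit viscosity, no force) with the Type-I bound and the
dissipation law is false, at every rotation rate `α` of the witness (pressure `−⟪c_α′(t), x⟫`). -/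
theorem finiteDissipationLiouville_false_classical (α : ℝ) :
    ¬ (∀ (C K : ℝ) (u : ℝ → E3 → E3) (p : ℝ → E3 → ℝ),
        IsClassicalNSSolutionOn (Iio 0) 1 0 u p →
        HasTypeITimeDecay C u →
        (∀ s : ℝ, s < 0 → ∫⁻ x, ‖fderiv ℝ (u s) x‖ₑ ^ 2 ≤ ENNReal.ofReal (K / Real.sqrt (-s))) →
        ¬ (∀ r > 0, ∀ M : ℝ, ∃ t ∈ Set.Ioo (-(r ^ 2)) (0 : ℝ),
            ∃ x ∈ Metric.ball (0 : E3) r, M < ‖u t x‖)) := fun h =>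
  h 1 0 _ _ (isClassicalNSSolutionOn_vecDrift (contDiffOn_rotConst α)) (rotConst_hasTypeITimeDecay α)
    (dissLaw_vecDrift 0 _) (rotConst_singular α)

/-- Constants are mild in the KNSS gauge: `e^{σΔ}c = c` and `B(c, c) = 0` (KNSS 2009 Rem. 6.1;
tree `oseenDuhamel_eq_zero_of_const`, `heatExtension_const`). -/
theorem const_mild_oseenDuhamel (c : E3) {s t : ℝ} (hst : s < t) (x : E3) :
    c = heatFlow (fun _ : E3 => c) (t - s) x - oseenDuhamel 1 s (fun _ _ => c) (fun _ _ => c) t x := by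
  rw [oseenDuhamel_eq_zero_of_const (u := fun _ _ => c) (v := fun _ _ => c) (b := fun _ => c)
      (c := fun _ => c) (fun _ _ _ => rfl) (fun _ _ _ => rfl) x,
    heatFlow_of_pos _ (sub_pos.2 hst),
    Literature.Analysis.UnboundedOperators.heatExtension_const c (sub_pos.2 hst) x, sub_zero]

/-- **The Liouville upgrade needs the Type-I decay, not boundedness.** Over the dissipative mild
class with BOUNDEDNESS (`‖u‖ ≤ 1`) in place of the Type-I bound, the conclusion `u ≡ 0` fails: the
constant field `e₀` is smooth, divergence free, KNSS-mild, bounded, has zero dissipation and does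
not vanish. (Constants are bounded at the apex — the regularity form of FDL holds for them — and are
excluded from `IsTypeIAncientMild` by the decay as `t → −∞`, tree `eq_zero_of_slice_const`.) -/
theorem dissipativeLiouville_false_bounded :
    ¬ (∀ (K : ℝ) (u : ℝ → E3 → E3),
        ContDiffOn ℝ (⊤ : ℕ∞) (uncurry u) (Iio 0 ×ˢ univ) →
        (∀ t < 0, VectorCalculus.IsDivFree (u t)) →
        (∀ s t : ℝ, s < t → t < 0 → ∀ x,
          u t x = heatFlow (u s) (t - s) x - oseenDuhamel 1 s u u t x) →
        (∀ t < 0, ∀ x, ‖u t x‖ ≤ 1) →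
        (∀ s : ℝ, s < 0 → ∫⁻ x, ‖fderiv ℝ (u s) x‖ₑ ^ 2 ≤ ENNReal.ofReal (K / Real.sqrt (-s))) →
        ∀ t < 0, ∀ x, u t x = 0) := fun h => by
  have key := h 0 (vecDrift fun _ => parasiticDir) contDiffOn_const
    (fun _ _ => isDivFree_fun_const parasiticDir)
    (fun _ _ hst _ x => const_mild_oseenDuhamel parasiticDir hst x)
    (fun _ _ _ => norm_parasiticDir.le) (dissLaw_vecDrift 0 fun _ => parasiticDir) (-1)
    (by norm_num) 0
  have hn := norm_parasiticDir
  rw [show parasiticDir = vecDrift (fun _ => parasiticDir) (-1) 0 from rfl, key, norm_zero] at hn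
  exact zero_ne_one hn

/-! ## The degenerate parameter corners hold -/

/-- **`K ≤ 0` forces the rest state.** Then `∫ ‖Dū(s)‖² = 0` for every `s < 0`; `Dū(s)` is
continuous and vanishes a.e., hence everywhere; every slice is spatially constant (mean value
theorem); and the gauge kills slice-constant members (`IsTypeIAncientMild.eq_zero_of_slice_const`). -/
theorem eq_zero_of_dissLaw_nonpos {C K : ℝ} {u : ℝ → E3 → E3} (hK : K ≤ 0)
    (h : IsTypeIAncientMild C u)
    (hD : ∀ s : ℝ, s < 0 → ∫⁻ x, ‖fderiv ℝ (u s) x‖ₑ ^ 2 ≤ ENNReal.ofReal (K / Real.sqrt (-s))) :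
    ∀ t < 0, ∀ x, u t x = 0 := by
  have hconst : ∀ s < 0, ∀ x, u s x = u s 0 := by
    intro s hs x
    have hsm : ContDiff ℝ (⊤ : ℕ∞) (u s) := h.contDiff_slice hs
    have hcont : Continuous (fderiv ℝ (u s)) := hsm.continuous_fderiv (by simp)
    have h0 : ∫⁻ x, ‖fderiv ℝ (u s) x‖ₑ ^ 2 = 0 := by
      have h1 := hD s hs
      rw [ENNReal.ofReal_eq_zero.2
        (div_nonpos_iff.2 (Or.inr ⟨hK, Real.sqrt_nonneg _⟩))] at h1
      exact nonpos_iff_eq_zero.1 h1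
    have h2 : (fun x => ‖fderiv ℝ (u s) x‖ₑ ^ 2) = 0 :=
      (lintegral_eq_zero_of_isAddLeftInvariant ((ENNReal.continuous_pow 2).comp hcont.enorm)).1 h0
    have h3 : ∀ x, fderiv ℝ (u s) x = 0 := fun x => by
      have hx : ‖fderiv ℝ (u s) x‖ₑ ^ 2 = 0 := congrFun h2 x
      rw [pow_eq_zero_iff two_ne_zero, ← ofReal_norm, ENNReal.ofReal_eq_zero] at hx
      exact norm_le_zero_iff.1 hx
    exact is_const_of_fderiv_eq_zero (hsm.differentiable (by simp)) h3 x 0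
  exact fun t ht x => h.eq_zero_of_slice_const (b := fun s => u s 0) hconst ht x

/-- FDL holds in the corner `K ≤ 0`. -/
theorem fdl_of_nonpos (C K : ℝ) (u : ℝ → E3 → E3) (hK : K ≤ 0) (h : IsTypeIAncientMild C u)
    (hD : ∀ s : ℝ, s < 0 → ∫⁻ x, ‖fderiv ℝ (u s) x‖ₑ ^ 2 ≤ ENNReal.ofReal (K / Real.sqrt (-s))) :
    ¬ (∀ r > 0, ∀ M : ℝ, ∃ t ∈ Set.Ioo (-(r ^ 2)) (0 : ℝ),
      ∃ x ∈ Metric.ball (0 : E3) r, M < ‖u t x‖) :=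
  not_singularAtApex_of_vanishes (eq_zero_of_dissLaw_nonpos hK h hD)

/-- FDL holds in the corner `C ≤ ε₀`: small Type-I members vanish (the accepted small-constant gap
`exists_eps_vanishes_of_le` of the sibling crux, bridged by `inClass_iff_isTypeIAncientMild`). -/
theorem fdl_of_small_typeI_constant :
    ∃ ε₀ : ℝ, 0 < ε₀ ∧ ∀ (C K : ℝ) (u : ℝ → E3 → E3), C ≤ ε₀ → IsTypeIAncientMild C u →
      (∀ s : ℝ, s < 0 → ∫⁻ x, ‖fderiv ℝ (u s) x‖ₑ ^ 2 ≤ ENNReal.ofReal (K / Real.sqrt (-s))) →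
      ¬ (∀ r > 0, ∀ M : ℝ, ∃ t ∈ Set.Ioo (-(r ^ 2)) (0 : ℝ),
          ∃ x ∈ Metric.ball (0 : E3) r, M < ‖u t x‖) := by
  obtain ⟨ε₀, hε₀, hgap⟩ := exists_eps_vanishes_of_le
  exact ⟨ε₀, hε₀, fun C K u hC hu _ =>
    not_singularAtApex_of_vanishes (hgap C u (inClass_iff_isTypeIAncientMild.2 hu) hC)⟩

end Summit.NavierStokesRegularity.NavierStokesRegularity.Theorems.FiniteDissipationLiouville.Negative

end
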